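import Summits.Ventures.PercRepro.ProfileTwoFat

/-!
# PercRepro — THE ROW `q = 2` OF THE PROFILE INEQUALITY ON SIMPLE COSIMPLE MATROIDS (p10, gen 2; S5 §2.5)

`proofs/SUBCLAIM-S5-p10.md` §2.5, Theorems B (cosimple case) and C and their corollary: for every SIMPLE matroid
`M` whose cocircuits all have at least three elements (no coloops, no series pairs), and every level `u ≥ 2`,

  `(Π_{2,u})   Σ_{B : ρ(B) = 2} price(B) ≤ #{S : ρ(S) = u}`     (`Profile.ProfileIneq M 2 u`).

The rank-`2` sets split into the independent pairs (`indepSets M 2`) and the fat ones (`fat2 M`), the rank-`u`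
sets into the independent `u`-sets and the dependent ones (`depU M u`).  The pairs are paid by the independent
`u`-sets (Theorem C, `indep_demand_le_choose_mul_card_indepSets`); a fat `B` is paid by the dependent rank-`u`
sets `B ∪ Y` of `ProfileTwoFat` (each charged once), of which there are `≥ C(ρ(E), u−2) ≥ demand(B)` because
`M / B` has rank `ρ(E) − 2` and cogirth `≥ 3` (the cogirth lemma).  Adding, with `C(u,2)·price = demand`
(`choose_mul_price`), gives the row; the level `u > ρ(E)` is the zero-price case.

* `fat_demand_le_card_depU` — Theorem B (cosimple case);
* `Rq_two_eq_union`, `levelSet_eq_union`, `choose_mul_price_eq_demand` — the two splits and the price;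
* **`profileIneq_two_of_cosimple`** — `(Π_{2,u})` for every `u ≥ 2` on every simple cosimple matroid.
-/

open scoped Matroid

namespace PercRepro.Cogirth

open Finset ThmH Skew Shadow Profile

variable {α : Type} [DecidableEq α] {M : Matroid α} [M.Finite]

/-! ### Theorem B (cosimple case) and the assembly -/

/-- **Theorem B, cosimple case**: on a simple matroid with cogirth `≥ 3`, the demand of the fat rank-`2` sets
is at most the number of dependent rank-`u` sets (so at most `C(u,2)` times it), for `2 ≤ u ≤ ρ(E)`. -/
theorem fat_demand_le_card_depU (hs : Simple' M) (hg : CogirthGe' M 3) {u : ℕ} (hu : 2 ≤ u)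
    (huR : u ≤ rk M (gr M)) :
    ∑ B ∈ fat2 M, demand M 2 u B ≤ (depU M u).card := by
  have hterm : ∀ B ∈ fat2 M, demand M 2 u B ≤ (indepSets (M ／ (B : Set α)) (u - 2)).card := by
    intro B hB
    have hBg : B ⊆ gr M := (mem_Rq.1 (mem_fat2.1 hB).1).1
    have hrkB : rk M B = 2 := rk_eq_of_mem_Rq (mem_fat2.1 hB).1
    have hg' : CogirthGe (M ／ (B : Set α)) 3 := cogirthGe_of_cogirthGe' (cogirthGe'_contract' hg hBg)
    have hrk := rk_gr_contract_add_rk hBg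
    rw [hrkB] at hrk
    have hA := choose_le_card_indepSets (M := M ／ (B : Set α)) (g := 3) (by omega) hg'
      (j := u - 2) (by omega)
    have hmono : (rk M (gr M \ B)).choose (u - 2) ≤
        (rk (M ／ (B : Set α)) (gr (M ／ (B : Set α))) + 3 - 1).choose (u - 2) := by
      apply Nat.choose_le_choose
      have := rk_mono' (M := M) (sdiff_subset : gr M \ B ⊆ gr M)
      omega
    unfold demand
    split_ifs with h
    · exact hmono.trans hA
    · exact Nat.zero_le _
  calc ∑ B ∈ fat2 M, demand M 2 u B
      ≤ ∑ B ∈ fat2 M, (indepSets (M ／ (B : Set α)) (u - 2)).card := sum_le_sum hterm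
    _ = (fatPairs M u).card := (card_fatPairs u).symm
    _ ≤ (depU M u).card := card_fatPairs_le_card_depU hs hu

open Classical in
/-- `Rq M 2` is the disjoint union of the independent pairs and the fat sets. -/
theorem Rq_two_eq_union : Rq M 2 = indepSets M 2 ∪ fat2 M := by
  ext B
  rw [mem_union, mem_fat2, mem_indepSets, mem_Rq]
  constructor
  · intro h
    by_cases hi : M.Indep (B : Set α)
    · left
      refine ⟨h.1, ?_, hi⟩
      have := rk_eq_card_of_indep hi
      have h2 := h.2
      rw [← coe_rk] at h2
      have h3 : rk M B = 2 := by exact_mod_cast h2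
      omega
    · right
      exact ⟨h, hi⟩
  · rintro (⟨hBg, hBc, hBi⟩ | ⟨h, _⟩)
    · refine ⟨hBg, ?_⟩
      rw [← coe_rk, rk_eq_card_of_indep hBi, hBc]
    · exact h

omit [DecidableEq α] in
open Classical in
/-- Independent pairs and fat sets are disjoint families. -/
theorem disjoint_indepSets_fat2 : Disjoint (indepSets M 2) (fat2 M) := by
  rw [disjoint_left]
  intro B h1 h2
  exact (mem_fat2.1 h2).2 (mem_indepSets.1 h1).2.2

open Classical in
/-- `levelSet M u` is the disjoint union of the independent `u`-sets and the dependent rank-`u` sets. -/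
theorem levelSet_eq_union (u : ℕ) : levelSet M u = indepSets M u ∪ depU M u := by
  ext S
  rw [mem_union, mem_depU, mem_indepSets, mem_levelSet]
  constructor
  · intro h
    by_cases hi : M.Indep (S : Set α)
    · left
      refine ⟨h.1, ?_, hi⟩
      have := rk_eq_card_of_indep hi
      have h2 := h.2
      rw [← coe_rk] at h2
      have h3 : rk M S = u := by exact_mod_cast h2
      omega
    · right
      exact ⟨h, hi⟩
  · rintro (⟨hSg, hSc, hSi⟩ | ⟨h, _⟩)
    · refine ⟨hSg, ?_⟩
      rw [← coe_rk, rk_eq_card_of_indep hSi, hSc]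
    · exact h

omit [DecidableEq α] in
open Classical in
/-- Independent `u`-sets and dependent rank-`u` sets are disjoint families. -/
theorem disjoint_indepSets_depU (u : ℕ) : Disjoint (indepSets M u) (depU M u) := by
  rw [disjoint_left]
  intro S h1 h2
  exact (mem_depU.1 h2).2 (mem_indepSets.1 h1).2.2

/-- `C(u,q) · price(B) = demand(B)` (as rationals). -/
theorem choose_mul_price_eq_demand (q u : ℕ) (hqu : q ≤ u) (B : Finset α) :
    (u.choose q : ℚ) * price M q u B = (demand M q u B : ℚ) := by
  rw [choose_mul_price q u hqu B]
  unfold demand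
  have hiff : ((u : ℕ∞) ≤ M.eRk ((gr M \ B : Finset α) : Set α)) ↔ u ≤ rk M (gr M \ B) := by
    rw [← coe_rk]
    exact Nat.cast_le
  by_cases h : u ≤ rk M (gr M \ B)
  · rw [if_pos (hiff.2 h), if_pos h]
    rfl
  · rw [if_neg (fun h' => h (hiff.1 h')), if_neg h]
    simp

/-- **THE ROW `q = 2` ON SIMPLE COSIMPLE MATROIDS.**  For every simple matroid whose cocircuits all have at least
three elements and every `u ≥ 2`: `Profile.ProfileIneq M 2 u`. -/
theorem profileIneq_two_of_cosimple (hs : Simple' M) (hg : CogirthGe' M 3) (u : ℕ) (hu : 2 ≤ u) :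
    ProfileIneq M 2 u := by
  unfold ProfileIneq
  rcases Nat.lt_or_ge (rk M (gr M)) u with hlt | huR
  · -- above the top level every price is `0`
    have hzero : ∀ B ∈ Rq M 2, price M 2 u B = 0 := by
      intro B _
      unfold price
      rw [if_neg]
      intro h
      rw [← coe_rk] at h
      have h' : u ≤ rk M (gr M \ B) := by exact_mod_cast h
      have := rk_mono' (M := M) (sdiff_subset : gr M \ B ⊆ gr M)
      omega
    rw [sum_eq_zero hzero]
    exact Nat.cast_nonneg _
  -- `u ≤ ρ(E)`: multiply by `C(u,2) > 0`
  have hpos : (0 : ℚ) < (u.choose 2 : ℚ) := by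
    exact_mod_cast Nat.choose_pos hu
  apply le_of_mul_le_mul_left _ hpos
  rw [mul_sum]
  simp_rw [choose_mul_price_eq_demand 2 u hu]
  rw [Rq_two_eq_union, sum_union disjoint_indepSets_fat2, levelSet_eq_union u,
    card_union_of_disjoint (disjoint_indepSets_depU u)]
  have h1 := indep_demand_le_choose_mul_card_indepSets (M := M) (q := 2) (u := u) hg hu huR
  have h2 := fat_demand_le_card_depU hs hg hu huR
  have h3 : (depU M u).card ≤ u.choose 2 * (depU M u).card :=
    Nat.le_mul_of_pos_left _ (Nat.choose_pos hu)
  have h4 : ∑ B ∈ indepSets M 2, demand M 2 u B + ∑ B ∈ fat2 M, demand M 2 u B ≤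
      u.choose 2 * ((indepSets M u).card + (depU M u).card) := by
    rw [Nat.mul_add]
    exact Nat.add_le_add h1 (h2.trans h3)
  exact_mod_cast h4

end PercRepro.Cogirth
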